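import Literature.Algebra.EuclideanDomain.NormalisedEuclideanAlgorithm
import Literature.Algebra.EuclideanDomain.TransfiniteSmallestAlgorithm
import Literature.Algebra.EuclideanDomain.UniversalSideDivisors
import Mathlib.SetTheory.Ordinal.Rank
import HarnessLib

/-!
# Isotone Euclidean functions, infima of Euclidean functions, generalized Euclidean functions
# (Clark 2015, §2.3 Cor. 8, §2.4 Thm. 11, Cor. 12, Ex. 2.4, §2.5 Lemma 13)

Topic `Literature/Algebra/EuclideanDomain`, namespace `Literature.Algebra.EuclideanDomain.Algorithm` (as in
`NormalisedEuclideanAlgorithm.lean`).  THEOREMS ONLY (no `def`, no instance, no named fact), all proved.  A Euclidean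
function («algorithm») is a map `φ : R → W` into a well-ordered set with Samuel's (E) `∀ a b, b ≠ 0 → ∃ q r, a = b q + r ∧
φ r < φ b` (hypothesis `hφ`, stated inline; Clark's functions live on `R•` with the escape `r = 0`, used verbatim in §3–§4
below); «weakly isotone» is `∀ a c, a c ≠ 0 → φ a ≤ φ (a c)` (`x ∣ y ⟹ φ x ≤ φ y` on `R•`), «isotone» is
`x ∣ y, y ∤ x, y ≠ 0 ⟹ φ x < φ y`.

## Source (read at the page)

P. L. Clark, *A note on Euclidean order types*, Order **32** (2015) 157–178 [Clark2015EuclideanOrderTypes] (materialised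
`paper:arxiv-1208.0977`, pp. 4–5), VERBATIM.  §2.3: «A generalized Euclidean function is a function `φ` from `R•` to an
Artinian ordered class `X` such that for all `x ∈ R`, `y ∈ R•`, there are `q, r ∈ R` with `a = qx + r` such that either
`r = 0` or `φ(r) < φ(b)`. … a ring admitting a generalized Euclidean function is principal. … **Lemma 7.** Let `X, Y` be
Artinian ordered classes, `φ : R → X` a generalized Euclidean function and `f : X → Y` an isotone map. Then `f ∘ φ` is a
generalized Euclidean function. **Corollary 8.** ([Samuel71], [Nagata85]) A ring which admits a generalized Euclidean
function is Euclidean.  Proof. If `φ : R → X` is generalized Euclidean, `λ_X ∘ φ : R → Ord` is Euclidean.»  §2.4: «A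
Euclidean function `φ : R → Ord` is weakly isotone (resp. isotone) if whenever `x` divides `y`, `φ(x) ≤ φ(y)` (resp.
whenever `x` strictly divides `y`, `φ(x) < φ(y)`).  **Example 2.4:** Define `φ : ℤ• → Ord•` by `1 ↦ 2` and `n ↦ |n|` else.
Then `φ` is Euclidean. But `(1) = (−1)` and `φ(1) ≠ φ(−1)`, so `φ` is not weakly isotone.  **Theorem 11.** Let
`φ : R• → Ord` be a Euclidean function. Then the set of isotone Euclidean functions `ψ ≤ φ` has a maximal element
`φ̲ : x ∈ R• ↦ min_{y ∈ (x)•} φ(y)`.  Proof. Step 1: … `φ̲` is a Euclidean function … Step 2: … `φ̲` is isotone … Step 3: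
By construction `φ̲ ≤ φ`. Moreover, if `ψ ≤ φ` is an isotone Euclidean function, then for all `a, c ∈ R` with `ac ≠ 0`,
`ψ(a) ≤ ψ(ac) ≤ φ(ac)`, so `ψ(a) ≤ φ̲(a)`.  **Corollary 12.** A Euclidean function is weakly isotone iff it is isotone.
Proof. … let `φ` be a weakly isotone Euclidean function, let `a, c ∈ R` with `ac ≠ 0`, and suppose `φ(ac) = φ(a)`. Write
`a = qac + r` with `r = 0` or `φ(r) < φ(ac) = φ(a)`. If `r ≠ 0`, then `φ(r) = φ(a(1 − qc)) ≥ φ(a)`, contradiction. So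
`r = 0` and `(a) = (ac)`.»  §2.5: «**Lemma 13.** Let `R` be a commutative ring. Then every nonempty subclass of `Euc(R)`
has an infimum in `Euc(R)`.  Proof. Let `𝒞 = {φ_c}` … let `φ` be the infimum in `Ord^R`; it suffices to show that `φ` is
Euclidean. Let `a, b ∈ R` with `b ∤ a`. Choose `i` such that `φ(b) = φᵢ(b)`. Since `φᵢ` is Euclidean, there are `q, r`
such that `φᵢ(r) < φᵢ(b)`, and then `φ(r) ≤ φᵢ(r) < φᵢ(b) = φ(b)`.»  Steps 1–2 of Thm. 11 are Samuel's Prop. 4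
[Samuel1971, p. 284], in the tree as `exists_normalised`.

## What is formalised

* §1 (§2.4) `apply_eq_of_associated` (a weakly isotone function is constant on associates, i.e. factors through
  `Prin R`); **Corollary 12** `apply_mul_eq_iff_of_monotone` (`φ(ac) = φ(a) ⟺ (ac) = (a)` for a weakly isotone Euclidean
  `φ`) and `lt_of_dvd_of_not_dvd` (weakly isotone ⟹ isotone); **Example 2.4** `Int.remark_algorithm_not_monotone`.
* §2 **Theorem 11**: `le_of_normalised` (Step 3: every weakly isotone `ψ ≤ φ` lies below `φ̲`) and
  **`exists_greatest_isotone`** (`φ̲` is Euclidean, isotone, `≤ φ`, and the greatest weakly isotone function below `φ`).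
* §3 **Lemma 13**: `exists_remainder_iInf` (the pointwise infimum of a non-empty family of Euclidean functions with values in
  a conditionally complete linear order with well-founded `<`, e.g. `Ord`, is Euclidean; Clark's form — Samuel's form is
  Samuel's Prop. 9, already `Literature.Algebra.EuclideanDomain.algorithm_iInf`).
* §4 **Corollary 8** for a generalized Euclidean function `φ : R → X` into ANY well-founded preorder («Artinian ordered
  class»): `exists_remainder_rank_comp` (`λ_X ∘ φ` is Euclidean, `λ_X = IsWellFounded.rank`), `isPrincipalIdealRing_of_generalized`
  («principal»), and **`forall_exists_mem_samuelSet_of_generalized`** («is Euclidean» in the tree's sense: the transfinite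
  construction exhausts `R`, via Samuel's form with values in `WithBot X`).

## Mathlib / tree search

Mathlib: `IsWellFounded.rank`, `IsWellFounded.rank_lt_of_rel`, `WithBot.instWellFoundedLT`, `ciInf_mem`, `ciInf_le`, `WellFoundedLT.toOrderBot`,
`Ideal.span_singleton_le_span_singleton`, `Units.mul_inv_cancel_right`.  Tree: `NormalisedEuclideanAlgorithm.lean`
(`exists_normalised` = Samuel Prop. 4 = Thm. 11 Steps 1–2 with (c); `Int.remark_algorithm` = the function of Ex. 2.4 is an
algorithm), `TransfiniteSmallestAlgorithm.lean` (`exists_mem_samuelSet_of_algorithm`, Samuel Prop. 11; `algorithm_iInf`, Samuel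
Prop. 9 = Lemma 13 in Samuel's form, whose proof is reused for Clark's form),
`UniversalSideDivisors.lean` (`isPrincipalIdealRing_of_remainder`), `EuclideanOrderTypeFinite.lean` (Cor. 12 for the bottom
function `θ` only: `samuelRank_le_of_dvd`, `samuelRank_lt_of_dvd_of_not_dvd`), `EuclideanOrderTypeProductUpperBound.lean`
(Lemma 7: `exists_remainder_comp_of_strictMono`), `BrookfieldLengthFunction.lean` (Lemma 1 `strictMono_iInf`, `λ_X = rank`),
`LocalizationOfEuclideanRings.lean` (`IsLocalization.algorithm_sInf`, an infimum over associates, not over functions).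
-/

namespace Literature.Algebra.EuclideanDomain.Algorithm

universe u v w

/-! ## §1 Weakly isotone versus isotone (Cor. 12, Ex. 2.4) -/

section Isotone

variable {R : Type u} [CommRing R] {W : Type v} [LinearOrder W] {φ : R → W}

/-- A weakly isotone function (`φ(a) ≤ φ(ac)` for `ac ≠ 0`) is constant on associates: it «induces a map on the ordered
set `Prin R` of principal ideals». [cite: Clark2015EuclideanOrderTypes, §2.4 (before Ex. 2.4)] -/
theorem apply_eq_of_associated (hmono : ∀ a c : R, a * c ≠ 0 → φ a ≤ φ (a * c)) {a b : R} (ha : a ≠ 0)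
    (h : Associated a b) : φ a = φ b := by
  obtain ⟨u, rfl⟩ := h
  have hau : a * u ≠ 0 := fun h0 ↦ ha (by rw [← Units.mul_inv_cancel_right a u, h0, zero_mul])
  refine le_antisymm (hmono a u hau) ?_
  have h := hmono (a * u) (↑u⁻¹ : R) (by rwa [Units.mul_inv_cancel_right])
  rwa [Units.mul_inv_cancel_right] at h

/-- **Corollary 12 (the computation): for a weakly isotone Euclidean function, `φ(ac) = φ(a)` iff `(ac) = (a)`**
(`ac ≠ 0`): «Write `a = qac + r` with `r = 0` or `φ(r) < φ(ac) = φ(a)`. If `r ≠ 0`, then `φ(r) = φ(a(1 − qc)) ≥ φ(a)`,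
contradiction. So `r = 0` and `(a) = (ac)`.» [cite: Clark2015EuclideanOrderTypes, Cor. 12; Samuel1971, Prop. 4 (b) (p. 284)] -/
theorem apply_mul_eq_iff_of_monotone (hφ : ∀ a b : R, b ≠ 0 → ∃ q r : R, a = b * q + r ∧ φ r < φ b)
    (hmono : ∀ a c : R, a * c ≠ 0 → φ a ≤ φ (a * c)) {a c : R} (hac : a * c ≠ 0) :
    φ (a * c) = φ a ↔ Ideal.span {a * c} = Ideal.span {a} := by
  have ha0 : a ≠ 0 := fun h ↦ hac (by rw [h, zero_mul])
  constructor
  · intro heq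
    obtain ⟨q, r, hqr, hr⟩ := hφ a (a * c) hac
    have hr' : r = a * (1 - c * q) := by linear_combination -hqr
    have hr0 : r = 0 := by
      by_contra hr0
      have h1 := hmono a (1 - c * q) (by rwa [← hr'])
      rw [← hr'] at h1
      rw [heq] at hr
      exact absurd hr (not_lt.mpr h1)
    refine le_antisymm (Ideal.span_singleton_le_span_singleton.mpr (Dvd.intro c rfl)) ?_
    rw [Ideal.span_singleton_le_span_singleton]
    exact ⟨q, by rw [hr0, add_zero] at hqr; exact hqr⟩
  · intro hspan
    have hmem : a ∈ Ideal.span {a * c} := by rw [hspan]; exact Ideal.mem_span_singleton_self a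
    obtain ⟨d, hd⟩ := Ideal.mem_span_singleton.mp hmem
    refine le_antisymm ?_ (hmono a c hac)
    have hacd : a * c * d ≠ 0 := by rw [← hd]; exact ha0
    have h := hmono (a * c) d hacd
    rwa [← hd] at h

/-- **Corollary 12 «A Euclidean function is weakly isotone iff it is isotone»**: the non-trivial direction — a weakly
isotone Euclidean function is isotone: `x ∣ y`, `y ∤ x`, `y ≠ 0 ⟹ φ(x) < φ(y)`. [cite: Clark2015EuclideanOrderTypes, Cor. 12] -/
theorem lt_of_dvd_of_not_dvd (hφ : ∀ a b : R, b ≠ 0 → ∃ q r : R, a = b * q + r ∧ φ r < φ b)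
    (hmono : ∀ a c : R, a * c ≠ 0 → φ a ≤ φ (a * c)) {x y : R} (hy : y ≠ 0) (hxy : x ∣ y) (hyx : ¬y ∣ x) :
    φ x < φ y := by
  obtain ⟨c, rfl⟩ := hxy
  refine lt_of_le_of_ne (hmono x c hy) fun heq ↦ hyx ?_
  have h := (apply_mul_eq_iff_of_monotone hφ hmono hy).1 heq.symm
  have hmem : x ∈ Ideal.span {x * c} := by rw [h]; exact Ideal.mem_span_singleton_self x
  exact Ideal.mem_span_singleton.1 hmem

end Isotone

/-- **Example 2.4**: the Euclidean function `φ(1) = 2`, `φ(n) = |n|` else on `ℤ` (an algorithm: `Int.remark_algorithm`)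
is NOT weakly isotone — «`(1) = (−1)` and `φ(1) ≠ φ(−1)`» (`φ(1) = 2 > 1 = φ(1 · (−1))`).
[cite: Clark2015EuclideanOrderTypes, Ex. 2.4; Samuel1971, §2 Remark (p. 284)] -/
theorem Int.remark_algorithm_not_monotone :
    ¬∀ a c : ℤ, a * c ≠ 0 → (if a = 1 then 2 else a.natAbs) ≤ (if a * c = 1 then 2 else (a * c).natAbs) := by
  intro h
  have h1 := h 1 (-1) (by decide)
  revert h1
  decide

/-! ## §2 Theorem 11: the greatest isotone Euclidean function below `φ` -/

section Greatest

variable {R : Type u} [CommRing R] {W : Type v} [LinearOrder W]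

/-- **Theorem 11, Step 3**: if `φ₁(0) = φ(0)` and `φ₁(a) = φ(ac)` for some `ac ≠ 0` (the clauses pinning down Samuel's
normalisation `φ̲(a) = min_{y ∈ (a)•} φ(y)`, `exists_normalised`), then every weakly isotone `ψ ≤ φ` satisfies `ψ ≤ φ₁`:
«`ψ(a) ≤ ψ(ac) ≤ φ(ac)`, so `ψ(a) ≤ φ̲(a)`». [cite: Clark2015EuclideanOrderTypes, Thm. 11 (Step 3)] -/
theorem le_of_normalised {ψ φ φ₁ : R → W} (hψφ : ∀ a, ψ a ≤ φ a) (hψ : ∀ a c : R, a * c ≠ 0 → ψ a ≤ ψ (a * c))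
    (h0 : φ₁ 0 = φ 0) (hdef : ∀ a : R, a ≠ 0 → ∃ c : R, a * c ≠ 0 ∧ φ₁ a = φ (a * c)) (a : R) : ψ a ≤ φ₁ a := by
  by_cases ha : a = 0
  · rw [ha, h0]
    exact hψφ 0
  · obtain ⟨c, hac, hc⟩ := hdef a ha
    rw [hc]
    exact (hψ a c hac).trans (hψφ _)

variable [WellFoundedLT W]

/-- **Theorem 11 «Let `φ : R• → Ord` be a Euclidean function. Then the set of isotone Euclidean functions `ψ ≤ φ` has a
maximal element `φ̲ : x ↦ min_{y ∈ (x)•} φ(y)`»**: there is a Euclidean `φ₁ ≤ φ`, weakly isotone and isotone, above every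
weakly isotone `ψ ≤ φ` (Steps 1–2 are Samuel's Prop. 4, `exists_normalised`; Step 3 is `le_of_normalised`; isotone by
Cor. 12). [cite: Clark2015EuclideanOrderTypes, Thm. 11; Samuel1971, Prop. 4 (p. 284)] -/
theorem exists_greatest_isotone {φ : R → W} (hφ : ∀ a b : R, b ≠ 0 → ∃ q r : R, a = b * q + r ∧ φ r < φ b) :
    ∃ φ₁ : R → W,
      (∀ a b : R, b ≠ 0 → ∃ q r : R, a = b * q + r ∧ φ₁ r < φ₁ b) ∧
      (∀ a c : R, a * c ≠ 0 → φ₁ a ≤ φ₁ (a * c)) ∧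
      (∀ x y : R, y ≠ 0 → x ∣ y → ¬y ∣ x → φ₁ x < φ₁ y) ∧
      (∀ a, φ₁ a ≤ φ a) ∧
      ∀ ψ : R → W, (∀ a c : R, a * c ≠ 0 → ψ a ≤ ψ (a * c)) → (∀ a, ψ a ≤ φ a) → ∀ a, ψ a ≤ φ₁ a := by
  obtain ⟨φ₁, h0, hdef, hE, hmono, -, hle⟩ := exists_normalised hφ
  exact ⟨φ₁, hE, hmono, fun x y hy hxy hyx ↦ lt_of_dvd_of_not_dvd hE hmono hy hxy hyx, hle,
    fun ψ hψ hψφ ↦ le_of_normalised hψφ hψ h0 fun a ha ↦ (hdef a ha).1⟩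

end Greatest

/-! ## §3 Lemma 13: infima of Euclidean functions -/

section Infimum

variable {R : Type u} [CommRing R] {W : Type v} [ConditionallyCompleteLinearOrder W] [WellFoundedLT W]
  {ι : Type w} [Nonempty ι] {φ : ι → R → W}

/-- **Lemma 13 «every nonempty subclass of `Euc(R)` has an infimum in `Euc(R)`»** in Clark's form (functions on `R•`,
remainder `r = 0` allowed): the pointwise infimum of a non-empty family of Euclidean functions is Euclidean — «Choose `i`
such that `φ(b) = φᵢ(b)`. … then `φ(r) ≤ φᵢ(r) < φᵢ(b) = φ(b)`» (values in any conditionally complete linear order with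
well-founded `<`, e.g. `Ord`, `ℕ`; Samuel's form of (E) is Samuel's Prop. 9, `algorithm_iInf` in
`TransfiniteSmallestAlgorithm.lean`). [cite: Clark2015EuclideanOrderTypes, Lemma 13; Samuel1971, Prop. 9 (p. 288)] -/
theorem exists_remainder_iInf (hφ : ∀ i, ∀ a b : R, b ≠ 0 → ∃ q r : R, a = b * q + r ∧ (r = 0 ∨ φ i r < φ i b)) :
    ∀ a b : R, b ≠ 0 → ∃ q r : R, a = b * q + r ∧ (r = 0 ∨ (⨅ i, φ i r) < ⨅ i, φ i b) := by
  intro a b hb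
  obtain ⟨i, hi⟩ := ciInf_mem fun j ↦ φ j b
  obtain ⟨q, r, hqr, hr⟩ := hφ i a b hb
  refine ⟨q, r, hqr, hr.imp_right fun h ↦ ?_⟩
  haveI : Nonempty W := ⟨φ i b⟩
  letI : OrderBot W := WellFoundedLT.toOrderBot W
  calc (⨅ j, φ j r) ≤ φ i r := ciInf_le ⟨⊥, fun _ _ ↦ bot_le⟩ i
    _ < φ i b := h
    _ = ⨅ j, φ j b := hi

end Infimum

/-! ## §4 Corollary 8: generalized Euclidean functions -/

section Generalized

variable {R : Type u} [CommRing R] {X : Type v} [Preorder X] [WellFoundedLT X] {φ : R → X}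

/-- **Corollary 8, the proof «If `φ : R → X` is generalized Euclidean, `λ_X ∘ φ : R → Ord` is Euclidean»** for a generalized
Euclidean function with values in any well-founded preorder («Artinian ordered class») `X`, `λ_X = IsWellFounded.rank` the
length function of `X` (an isotone map, Lemma 7). [cite: Clark2015EuclideanOrderTypes, Cor. 8 and Lemma 7] -/
theorem exists_remainder_rank_comp
    (hφ : ∀ a b : R, b ≠ 0 → ∃ q r : R, a = b * q + r ∧ (r = 0 ∨ φ r < φ b)) :
    ∀ a b : R, b ≠ 0 → ∃ q r : R, a = b * q + r ∧
      (r = 0 ∨ IsWellFounded.rank (α := X) (· < ·) (φ r) < IsWellFounded.rank (α := X) (· < ·) (φ b)) := by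
  intro a b hb
  obtain ⟨q, r, hqr, hr⟩ := hφ a b hb
  exact ⟨q, r, hqr, hr.imp_right fun h ↦ IsWellFounded.rank_lt_of_rel h⟩

/-- «A ring admitting a generalized Euclidean function is principal» (values in any well-founded preorder).
[cite: Clark2015EuclideanOrderTypes, §2.3 (before Lemma 7) and Cor. 8] -/
theorem isPrincipalIdealRing_of_generalized
    (hφ : ∀ a b : R, b ≠ 0 → ∃ q r : R, a = b * q + r ∧ (r = 0 ∨ φ r < φ b)) : IsPrincipalIdealRing R :=
  isPrincipalIdealRing_of_remainder (InvImage (· < ·) φ) (InvImage.wf φ wellFounded_lt) hφ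

/-- **Corollary 8 «A ring which admits a generalized Euclidean function is Euclidean»**, in the tree's transfinite sense: the
transfinite construction exhausts `R` (so the smallest algorithm `θ` is an ordinal-valued Euclidean function).  Proof here:
`ψ(0) = ⊥`, `ψ(x) = φ(x)` for `x ≠ 0` is an algorithm in Samuel's sense with values in the well-founded `WithBot X`, and
Samuel's Prop. 11 (`exists_mem_samuelSet_of_algorithm`) applies. [cite: Clark2015EuclideanOrderTypes, Cor. 8; Samuel1971,
Prop. 11 (p. 290)] -/
theorem forall_exists_mem_samuelSet_of_generalized
    (hφ : ∀ a b : R, b ≠ 0 → ∃ q r : R, a = b * q + r ∧ (r = 0 ∨ φ r < φ b)) :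
    ∀ x : R, ∃ α : Ordinal.{u}, x ∈ samuelSet R α := by
  classical
  let ψ : R → WithBot X := fun x ↦ if x = 0 then ⊥ else (φ x : WithBot X)
  have hψ0 : ψ 0 = ⊥ := if_pos rfl
  have hψ : ∀ a b : R, b ≠ 0 → ∃ q r : R, a = b * q + r ∧ ψ r < ψ b := by
    intro a b hb
    obtain ⟨q, r, hqr, hr⟩ := hφ a b hb
    refine ⟨q, r, hqr, ?_⟩
    have hψb : ψ b = (φ b : WithBot X) := if_neg hb
    by_cases hr0 : r = 0
    · rw [hr0, hψ0, hψb]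
      exact WithBot.bot_lt_coe _
    · rcases hr with h | h
      · exact (hr0 h).elim
      · rw [show ψ r = (φ r : WithBot X) from if_neg hr0, hψb]
        exact WithBot.coe_lt_coe.2 h
  exact fun x ↦ exists_mem_samuelSet_of_algorithm ψ hψ x

end Generalized

end Literature.Algebra.EuclideanDomain.Algorithm
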